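import Mathlib
import Summits.Ventures.PercRepro2.K5Conn
import Summits.Ventures.PercRepro2.K5TypedK3Marks
import Summits.Ventures.PercRepro2.PMK5Theorem
import Summits.Ventures.PercRepro2.PMPendantBeta

/-!
# (HCOV) ON EVERY `K₅ + PENDANT a₃` INSTANCE, FOR EVERY WEIGHT VECTOR — the weighted (PM) closes the
pendant class over five-vertex bases (blind cell PercRepro2, mine-2 g22; rows 2′BETA1 → 2′HCOV)

`ends6 : Fin 11 → Sym2 (Fin 6)` is `K₅` on the marks `o = 0, a₁ = 1, a₂ = 2, u = 3, b = 4` (the ten edges of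
`K5.ends5`, vertices embedded by `Fin.castSucc`) plus the pendant edge `10 = {3, 5}` to the leaf `a₃ = 5`.
Every simple graph on the six vertices `o, a₁, a₂, b, u, a₃` in which `a₃` is a leaf at the UNMARKED vertex
`u` is `ends6` with zero weights, so **`HCov_K5pendant`** — `CovForm.HCov p ends6 0 1 2 5 4` for every
`p ∈ [0,1]^11` — is (HCOV) on the whole pendant-`a₃` class (the (PM) setting: `a₃` hanging at an unmarked
vertex) over five-vertex bases, all weights.  (`a₃` hanging at a MARK is a different class, not covered.)

The proof composes three tree theorems through one transfer lemma:
* `PMPendant.HCov_pendant_of_beta1` (the weighted (PM) dictionary): (HCOV) at the pendant instance follows from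
  `0 ≤ β₁` at the base with `a₃` isolated and (HCOV) at the base with `a₃ := u`;
* `K5.PM.beta1_K5` (the kernel certificate): `0 ≤ β₁` on `K₅` for every weight vector;
* `K5.HCov_K5` (typer-1 g10, via the typed `K₃` base of `K5TypedK3Marks.lean`): (HCOV) on `K₅` for every weight vector;
* **the transfer** (`prob_res`, `connEvent6_eq`): restricting a configuration of `ends6` to the ten `K₅`
  edges (`res`) maps the product measure to the product measure (the pendant weight sums out), and a
  connection among the first five vertices of `ends6` is the same connection in `ends5` (the leaf `5` is a
  dead end), so every mass of `β₁` and of `Gc` on `ends6` with `a₃` isolated is the corresponding mass on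
  `ends5` (`beta1_base`, `Gc_base`).
-/

namespace Summit.Ventures.PercRepro2

open CovForm

namespace K5

namespace Pendant

/-! ## The graph -/

/-- `K₅` on `0, …, 4` plus the pendant edge `{3, 5}` (edge `10`). -/
def ends6 : Fin 11 → Sym2 (Fin 6) :=
  Fin.snoc (α := fun _ => Sym2 (Fin 6)) (fun e => (ends5 e).map Fin.castSucc) s(3, 5)

/-- The ten `K₅` edges of `ends6`. -/
lemma ends6_castSucc (e : Fin 10) : ends6 (Fin.castSucc e) = (ends5 e).map Fin.castSucc := by
  simp [ends6]

/-- The pendant edge of `ends6`. -/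
lemma ends6_last : ends6 (Fin.last 10) = s(3, 5) :=
  Fin.snoc_last _ _

/-- The restriction of a configuration of `ends6` to the ten `K₅` edges. -/
def res (ω : Config (Fin 11)) : Config (Fin 10) := fun e => ω (Fin.castSucc e)

/-- `res` of a `snoc` is the initial segment. -/
lemma res_snoc (ω : Config (Fin 10)) (c : Bool) :
    res (Fin.snoc (α := fun _ => Bool) ω c) = ω := by
  funext e; simp [res]

/-- The leaf `5` is not an endpoint of a `K₅` edge. -/
lemma five_notMem_castSucc (e : Fin 10) : (5 : Fin 6) ∉ ends6 (Fin.castSucc e) := by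
  rw [ends6_castSucc, Sym2.mem_map]
  rintro ⟨v, _, hv⟩
  have := Fin.castSucc_lt_last v
  rw [hv] at this
  exact absurd this (by decide)

/-- `5` is a leaf of `ends6`: its only edge is the pendant edge. -/
lemma leaf_five : ∀ e, (5 : Fin 6) ∈ ends6 e → e = Fin.last 10 := by
  intro e he
  induction e using Fin.lastCases with
  | last => rfl
  | cast e => exact absurd he (five_notMem_castSucc e)

/-! ## The transfer of probabilities -/

section Prob

variable {R : Type*} [Field R]

/-- The weight of a `snoc` configuration factors. -/
lemma weight_snoc (p : Fin 11 → R) (ω : Config (Fin 10)) (c : Bool) :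
    weight p (Fin.snoc (α := fun _ => Bool) ω c) =
      weight (p ∘ Fin.castSucc) ω * edgeFactor (p (Fin.last 10)) c := by
  unfold weight
  rw [Fin.prod_univ_castSucc, Fin.snoc_last]
  simp only [Fin.snoc_castSucc, Function.comp_apply]

/-- **The transfer of probabilities**: the probability under `p` of the pull-back of an event of the ten
`K₅` edges is its probability under `p ∘ Fin.castSucc` (the pendant weight sums out). -/
theorem prob_res (p : Fin 11 → R) (A : Set (Config (Fin 10))) :
    prob p (res ⁻¹' A) = prob (p ∘ Fin.castSucc) A := by
  classical
  unfold prob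
  conv_lhs => rw [← (Fin.snocEquiv fun _ => Bool).sum_comp]
  rw [Fintype.sum_prod_type]
  simp only [Fin.snocEquiv, Equiv.coe_fn_mk, Set.indicator_apply, Set.mem_preimage, res_snoc,
    weight_snoc]
  rw [Finset.sum_comm]
  refine Finset.sum_congr rfl fun ω _ => ?_
  by_cases h : ω ∈ A
  · simp only [h, if_true, ← Finset.mul_sum]
    have : ∑ c : Bool, edgeFactor (p (Fin.last 10)) c = (1 : R) := by
      rw [Fintype.sum_bool]; exact edgeFactor_true_add_false (p (Fin.last 10))
    rw [this, mul_one]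
  · simp [h]

end Prob

/-! ## The transfer of connections -/

/-- A connection in `ends5` lifts to `ends6`. -/
lemma conn6_of_conn_res {ω : Config (Fin 11)} {x y : Fin 5} (h : Conn ends5 (res ω) x y) :
    Conn ends6 ω (Fin.castSucc x) (Fin.castSucc y) := by
  let φ : openGraph ends5 (res ω) →g openGraph ends6 ω :=
    ⟨Fin.castSucc, fun {a c} hac => by
      rw [openGraph_adj] at hac ⊢
      obtain ⟨hne, e, he, hends⟩ := hac
      exact ⟨(Fin.castSucc_injective 5).ne hne, Fin.castSucc e, he,
        by rw [ends6_castSucc, hends, Sym2.map_mk]⟩⟩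
  exact h.map φ

/-- A connection in `ends6` between two vertices other than the leaf is a connection in `ends5`
(the closure argument: the leaf `5` is a dead end at `3`). -/
lemma conn_res_of_conn6 {ω : Config (Fin 11)} {x y : Fin 5}
    (h : Conn ends6 ω (Fin.castSucc x) (Fin.castSucc y)) : Conn ends5 (res ω) x y := by
  let S : Set (Fin 6) := {v | (v = 5 ∧ Conn ends5 (res ω) x 3) ∨
    ∃ w : Fin 5, v = Fin.castSucc w ∧ Conn ends5 (res ω) x w}
  have h5 : ∀ w : Fin 5, Fin.castSucc w ≠ (5 : Fin 6) := fun w hw => by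
    have := Fin.castSucc_lt_last w
    rw [hw] at this
    exact absurd this (by decide)
  have hS : ∀ a ∈ S, ∀ c, (openGraph ends6 ω).Adj a c → c ∈ S := by
    intro a ha c hac
    rw [openGraph_adj] at hac
    obtain ⟨_, e, he, hends⟩ := hac
    induction e using Fin.lastCases with
    | last =>
      rw [ends6_last, Sym2.eq_iff] at hends
      rcases hends with ⟨rfl, rfl⟩ | ⟨rfl, rfl⟩
      · -- `a = 3`, `c = 5`
        rcases ha with ⟨h35, _⟩ | ⟨w, hw, hxw⟩
        · exact absurd h35 (by decide)
        · have : w = 3 := Fin.castSucc_injective _ (hw.symm.trans (by decide))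
          subst this
          exact Or.inl ⟨rfl, hxw⟩
      · -- `a = 5`, `c = 3`
        rcases ha with ⟨_, hx3⟩ | ⟨w, hw, _⟩
        · exact Or.inr ⟨3, by decide, hx3⟩
        · exact absurd hw.symm (h5 w)
    | cast e =>
      rw [ends6_castSucc] at hends
      induction hends5 : ends5 e using Sym2.ind with
      | h a' c' =>
        rw [hends5, Sym2.map_mk, Sym2.eq_iff] at hends
        have hadj : Conn ends5 (res ω) a' c' :=
          conn_of_openAdj ⟨e, he, hends5⟩
        rcases hends with ⟨rfl, rfl⟩ | ⟨rfl, rfl⟩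
        · rcases ha with ⟨h5', _⟩ | ⟨w, hw, hxw⟩
          · exact absurd h5' (h5 a')
          · have : w = a' := Fin.castSucc_injective _ hw.symm
            subst this
            exact Or.inr ⟨c', rfl, conn_trans hxw hadj⟩
        · rcases ha with ⟨h5', _⟩ | ⟨w, hw, hxw⟩
          · exact absurd h5' (h5 c')
          · have : w = c' := Fin.castSucc_injective _ hw.symm
            subst this
            exact Or.inr ⟨a', rfl, conn_trans hxw (conn_symm hadj)⟩
  have hy : Fin.castSucc y ∈ S :=
    mem_of_conn_of_closed hS (Or.inr ⟨x, rfl, conn_refl _ _ _⟩) h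
  rcases hy with ⟨h5', _⟩ | ⟨w, hw, hxw⟩
  · exact absurd h5' (h5 y)
  · have : w = y := Fin.castSucc_injective _ hw.symm
    subst this
    exact hxw

/-- **The transfer of connection events**: among the first five vertices, `ends6`'s connection events are
the pull-backs of `ends5`'s. -/
theorem connEvent6_eq (x y : Fin 5) :
    connEvent ends6 (Fin.castSucc x) (Fin.castSucc y) = res ⁻¹' connEvent ends5 x y := by
  ext ω
  exact ⟨conn_res_of_conn6, conn6_of_conn_res⟩


/-! ## The instance: `K₅ + pendant a₃`, every weight vector -/

section Instance

variable {R : Type*} [Field R] [LinearOrder R] [IsStrictOrderedRing R]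

omit [IsStrictOrderedRing R] in
/-- The `K₅`-restriction of an admissible weight vector is admissible. -/
lemma isProbVec_comp {p : Fin 11 → R} (hp : IsProbVec p) : IsProbVec (p ∘ Fin.castSucc) :=
  ⟨fun _ => hp.nonneg _, fun _ => hp.le_one _⟩

omit [LinearOrder R] [IsStrictOrderedRing R] in
/-- The first five vertices of `ends6`, as numerals. -/
lemma cs0 : Fin.castSucc (0 : Fin 5) = (0 : Fin 6) := by decide
omit [LinearOrder R] [IsStrictOrderedRing R] in
/-- The first five vertices of `ends6`, as numerals. -/
lemma cs1 : Fin.castSucc (1 : Fin 5) = (1 : Fin 6) := by decide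
omit [LinearOrder R] [IsStrictOrderedRing R] in
/-- The first five vertices of `ends6`, as numerals. -/
lemma cs2 : Fin.castSucc (2 : Fin 5) = (2 : Fin 6) := by decide
omit [LinearOrder R] [IsStrictOrderedRing R] in
/-- The first five vertices of `ends6`, as numerals. -/
lemma cs3 : Fin.castSucc (3 : Fin 5) = (3 : Fin 6) := by decide
omit [LinearOrder R] [IsStrictOrderedRing R] in
/-- The first five vertices of `ends6`, as numerals. -/
lemma cs4 : Fin.castSucc (4 : Fin 5) = (4 : Fin 6) := by decide

omit [LinearOrder R] [IsStrictOrderedRing R] in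
/-- The transfer of the connection events among the marks, numeral form. -/
lemma c12 : connEvent ends6 1 2 = res ⁻¹' connEvent ends5 1 2 := by
  have h := connEvent6_eq 1 2; rwa [cs1, cs2] at h
omit [LinearOrder R] [IsStrictOrderedRing R] in
/-- The transfer of the connection events among the marks, numeral form. -/
lemma c21 : connEvent ends6 2 1 = res ⁻¹' connEvent ends5 2 1 := by
  have h := connEvent6_eq 2 1; rwa [cs1, cs2] at h
omit [LinearOrder R] [IsStrictOrderedRing R] in
/-- The transfer of the connection events among the marks, numeral form. -/
lemma c10 : connEvent ends6 1 0 = res ⁻¹' connEvent ends5 1 0 := by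
  have h := connEvent6_eq 1 0; rwa [cs1, cs0] at h
omit [LinearOrder R] [IsStrictOrderedRing R] in
/-- The transfer of the connection events among the marks, numeral form. -/
lemma c20 : connEvent ends6 2 0 = res ⁻¹' connEvent ends5 2 0 := by
  have h := connEvent6_eq 2 0; rwa [cs2, cs0] at h
omit [LinearOrder R] [IsStrictOrderedRing R] in
/-- The transfer of the connection events among the marks, numeral form. -/
lemma c13 : connEvent ends6 1 3 = res ⁻¹' connEvent ends5 1 3 := by
  have h := connEvent6_eq 1 3; rwa [cs1, cs3] at h
omit [LinearOrder R] [IsStrictOrderedRing R] in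
/-- The transfer of the connection events among the marks, numeral form. -/
lemma c23 : connEvent ends6 2 3 = res ⁻¹' connEvent ends5 2 3 := by
  have h := connEvent6_eq 2 3; rwa [cs2, cs3] at h
omit [LinearOrder R] [IsStrictOrderedRing R] in
/-- The transfer of the connection events among the marks, numeral form. -/
lemma c31 : connEvent ends6 3 1 = res ⁻¹' connEvent ends5 3 1 := by
  have h := connEvent6_eq 3 1; rwa [cs3, cs1] at h
omit [LinearOrder R] [IsStrictOrderedRing R] in
/-- The transfer of the connection events among the marks, numeral form. -/
lemma c32 : connEvent ends6 3 2 = res ⁻¹' connEvent ends5 3 2 := by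
  have h := connEvent6_eq 3 2; rwa [cs3, cs2] at h
omit [LinearOrder R] [IsStrictOrderedRing R] in
/-- The transfer of the connection events among the marks, numeral form. -/
lemma c14 : connEvent ends6 1 4 = res ⁻¹' connEvent ends5 1 4 := by
  have h := connEvent6_eq 1 4; rwa [cs1, cs4] at h
omit [LinearOrder R] [IsStrictOrderedRing R] in
/-- The transfer of the connection events among the marks, numeral form. -/
lemma c24 : connEvent ends6 2 4 = res ⁻¹' connEvent ends5 2 4 := by
  have h := connEvent6_eq 2 4; rwa [cs2, cs4] at h

omit [LinearOrder R] [IsStrictOrderedRing R] in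
/-- `Q` transfers. -/
lemma avoidAll6 : avoidAll ends6 2 {1} = res ⁻¹' avoidAll ends5 2 {1} := by
  rw [PMPendant.avoidAll_eq_compl, PMPendant.avoidAll_eq_compl, c12, Set.preimage_compl]

omit [LinearOrder R] [IsStrictOrderedRing R] in
/-- `T` transfers. -/
lemma TEvent6_123 : TEvent ends6 1 2 3 = res ⁻¹' TEvent ends5 1 2 3 := by
  unfold TEvent; rw [c21, c23, Set.preimage_inter, Set.preimage_compl]

omit [LinearOrder R] [IsStrictOrderedRing R] in
/-- `T′` transfers. -/
lemma TEvent6_213 : TEvent ends6 2 1 3 = res ⁻¹' TEvent ends5 2 1 3 := by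
  unfold TEvent; rw [c12, c13, Set.preimage_inter, Set.preimage_compl]

omit [LinearOrder R] [IsStrictOrderedRing R] in
/-- `PD` transfers. -/
lemma PDEvent6 : PDEvent ends6 1 2 3 = res ⁻¹' PDEvent ends5 1 2 3 := by
  simp only [PDEvent, Dtilde, UnionCluster.inU, c12, c31, c32, Set.preimage_inter, Set.preimage_compl,
    Set.preimage_union]

/-- **(HCOV) at the base `K₅` inside `ends6`** (the leaf isolated), from typer-1's `HCov_K5`. -/
theorem HCov_base (p : Fin 11 → R) (hp : IsProbVec p) :
    HCov (Function.update p (Fin.last 10) 0) ends6 0 1 2 3 4 := by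
  have h := HCov_K5 ((Function.update p (Fin.last 10) 0) ∘ Fin.castSucc)
    (isProbVec_comp (hp.update _ (le_refl _) zero_le_one))
  unfold HCov Gc DEF EQbo EQb3 EQb3o EQo EQ3 EQ3o PDb PDbo Do gap at h ⊢
  simp only [avoidAll6, TEvent6_123, TEvent6_213, PDEvent6, c10, c20, c14, c24, ← Set.preimage_inter,
    prob_res]
  exact h

/-- **`β₁ ≥ 0` at the base `K₅` inside `ends6`** (the leaf isolated), from the kernel certificate
`PM.beta1_K5`. -/
theorem beta1_base (p : Fin 11 → R) (hp : IsProbVec p) :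
    0 ≤ prob (Function.update p (Fin.last 10) 0) (connEvent ends6 1 2)ᶜ *
          (prob (Function.update p (Fin.last 10) 0) (connEvent ends6 1 2)ᶜ * prob (Function.update p (Fin.last 10) 0) (connEvent ends6 1 4 ∩ connEvent ends6 2 3 ∩ (connEvent ends6 1 0 ∪ connEvent ends6 2 0) ∩ (connEvent ends6 1 2)ᶜ) -
            prob (Function.update p (Fin.last 10) 0) (connEvent ends6 1 4 ∩ (connEvent ends6 1 2)ᶜ) * prob (Function.update p (Fin.last 10) 0) (connEvent ends6 2 3 ∩ (connEvent ends6 1 0 ∪ connEvent ends6 2 0) ∩ (connEvent ends6 1 2)ᶜ)) -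
        prob (Function.update p (Fin.last 10) 0) ((connEvent ends6 1 0 ∪ connEvent ends6 2 0) ∩ (connEvent ends6 1 2)ᶜ) *
          (prob (Function.update p (Fin.last 10) 0) (connEvent ends6 1 2)ᶜ * prob (Function.update p (Fin.last 10) 0) (connEvent ends6 1 4 ∩ connEvent ends6 2 3 ∩ (connEvent ends6 1 2)ᶜ) -
            prob (Function.update p (Fin.last 10) 0) (connEvent ends6 1 4 ∩ (connEvent ends6 1 2)ᶜ) * prob (Function.update p (Fin.last 10) 0) (connEvent ends6 2 3 ∩ (connEvent ends6 1 2)ᶜ)) -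
        prob (Function.update p (Fin.last 10) 0) (connEvent ends6 1 2)ᶜ *
          (prob (Function.update p (Fin.last 10) 0) (connEvent ends6 1 2)ᶜ * prob (Function.update p (Fin.last 10) 0) (connEvent ends6 1 4 ∩ connEvent ends6 2 0 ∩ (connEvent ends6 1 2)ᶜ) -
            prob (Function.update p (Fin.last 10) 0) (connEvent ends6 1 4 ∩ (connEvent ends6 1 2)ᶜ) * prob (Function.update p (Fin.last 10) 0) (connEvent ends6 2 0 ∩ (connEvent ends6 1 2)ᶜ)) +
        prob (Function.update p (Fin.last 10) 0) (connEvent ends6 1 2)ᶜ *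
          (prob (Function.update p (Fin.last 10) 0) (connEvent ends6 1 2)ᶜ * prob (Function.update p (Fin.last 10) 0) (connEvent ends6 2 4 ∩ connEvent ends6 1 3 ∩ (connEvent ends6 1 0 ∪ connEvent ends6 2 0) ∩ (connEvent ends6 1 2)ᶜ) -
            prob (Function.update p (Fin.last 10) 0) (connEvent ends6 2 4 ∩ (connEvent ends6 1 2)ᶜ) * prob (Function.update p (Fin.last 10) 0) (connEvent ends6 1 3 ∩ (connEvent ends6 1 0 ∪ connEvent ends6 2 0) ∩ (connEvent ends6 1 2)ᶜ)) -
        prob (Function.update p (Fin.last 10) 0) ((connEvent ends6 1 0 ∪ connEvent ends6 2 0) ∩ (connEvent ends6 1 2)ᶜ) *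
          (prob (Function.update p (Fin.last 10) 0) (connEvent ends6 1 2)ᶜ * prob (Function.update p (Fin.last 10) 0) (connEvent ends6 2 4 ∩ connEvent ends6 1 3 ∩ (connEvent ends6 1 2)ᶜ) -
            prob (Function.update p (Fin.last 10) 0) (connEvent ends6 2 4 ∩ (connEvent ends6 1 2)ᶜ) * prob (Function.update p (Fin.last 10) 0) (connEvent ends6 1 3 ∩ (connEvent ends6 1 2)ᶜ)) -
        prob (Function.update p (Fin.last 10) 0) (connEvent ends6 1 2)ᶜ *
          (prob (Function.update p (Fin.last 10) 0) (connEvent ends6 1 2)ᶜ * prob (Function.update p (Fin.last 10) 0) (connEvent ends6 2 4 ∩ connEvent ends6 1 0 ∩ (connEvent ends6 1 2)ᶜ) -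
            prob (Function.update p (Fin.last 10) 0) (connEvent ends6 2 4 ∩ (connEvent ends6 1 2)ᶜ) * prob (Function.update p (Fin.last 10) 0) (connEvent ends6 1 0 ∩ (connEvent ends6 1 2)ᶜ)) +
        (prob (Function.update p (Fin.last 10) 0) ((connEvent ends6 1 3 ∪ connEvent ends6 2 3) ∩ (connEvent ends6 1 2)ᶜ) - prob (Function.update p (Fin.last 10) 0) (connEvent ends6 1 2)ᶜ) *
          (prob (Function.update p (Fin.last 10) 0) (connEvent ends6 1 2)ᶜ * prob (Function.update p (Fin.last 10) 0) (connEvent ends6 1 4 ∩ connEvent ends6 2 0 ∩ (connEvent ends6 1 2)ᶜ) - prob (Function.update p (Fin.last 10) 0) (connEvent ends6 1 4 ∩ (connEvent ends6 1 2)ᶜ) * prob (Function.update p (Fin.last 10) 0) (connEvent ends6 2 0 ∩ (connEvent ends6 1 2)ᶜ) +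
            prob (Function.update p (Fin.last 10) 0) (connEvent ends6 1 2)ᶜ * prob (Function.update p (Fin.last 10) 0) (connEvent ends6 2 4 ∩ connEvent ends6 1 0 ∩ (connEvent ends6 1 2)ᶜ) - prob (Function.update p (Fin.last 10) 0) (connEvent ends6 2 4 ∩ (connEvent ends6 1 2)ᶜ) * prob (Function.update p (Fin.last 10) 0) (connEvent ends6 1 0 ∩ (connEvent ends6 1 2)ᶜ)) := by
  have h := PM.beta1_K5 ((Function.update p (Fin.last 10) 0) ∘ Fin.castSucc)
    (isProbVec_comp (hp.update _ (le_refl _) zero_le_one))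
  simp only [c12, c14, c23, c10, c20, c24, c13, ← Set.preimage_inter, ← Set.preimage_union,
    ← Set.preimage_compl, prob_res]
  exact h

/-- **(HCOV) ON EVERY `K₅ + PENDANT a₃` INSTANCE, EVERY WEIGHT VECTOR**: `CovForm.HCov p ends6 0 1 2 5 4` for
every `p ∈ [0,1]^11` — the marks `(o, a₁, a₂, a₃, b) = (0, 1, 2, 5, 4)`, `a₃ = 5` a leaf at `u = 3`; hence (HCOV)
on every simple graph on `{o, a₁, a₂, b, u, a₃}` in which `a₃` is a leaf at the unmarked vertex `u` (the missing
edges at weight `0`). Composition: the weighted (PM) dictionary (`PMPendant.HCov_pendant_of_beta1`), the kernel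
certificate `PM.beta1_K5` and typer-1's `HCov_K5`, through the transfer `prob_res` / `connEvent6_eq`. -/
theorem HCov_K5pendant (p : Fin 11 → R) (hp : IsProbVec p) : HCov p ends6 0 1 2 5 4 :=
  PMPendant.HCov_pendant_of_beta1 (ends := ends6) (a₃ := 5) (u := 3) (f := Fin.last 10)
    (by rw [ends6_last, Sym2.eq_swap]) leaf_five (by decide) p 0 1 2 4 (by decide) (by decide) hp
    (by decide) (by decide) (beta1_base p hp) (HCov_base p hp)

end Instance

end Pendant

end K5

end Summit.Ventures.PercRepro2
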